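import Literature.Combinatorics.Sahi2008.ProvedCases
import HarnessLib

/-!
# Lieb–Sahi (2022), §2: the three-function inequality on the square, discrete form

Topic `Literature/Combinatorics/Sahi2008` (companion of `Functional.lean` — `sahiE`, `ex`, `SahiPositive`,
`IsFKGMeasure`; `Indicators.lean` — `setInd`, the layer cake `sahiPositive_iff_indicators`; `FKG.lean` —
`ex_mul_ex_le_ex_mul`; `CumulationCone.lean` — `sahiE_comp_equiv`; `ProvedCases.lean` — `ex_setInd`).

## Source (read 2026-08-19 from the materialised arXiv text, corpus `paper:arxiv-2107.09838`, pp. 5–6)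

E. H. Lieb, S. Sahi, *On the extension of the FKG inequality to `n` functions*, J. Math. Phys. **63** (2022)
043301 = arXiv:2107.09838 [LiebSahi2021], Section 2:

> "**THEOREM 2.1.** If `f, g, h` are positive monotone functions on `[0,1]²` then `E_3(f,g,h) ≥ 0`."

reduced there (Lemmas 2.2, 2.3) to the discrete statement which is what we formalise:

> "Let `𝒜 = 𝒜(m)` be the set of decreasing `m`-tuples of integers, each between `0` and `m`,
> `𝒜(m) := {a ∈ ℤ^m | m ≥ a_1 ≥ ⋯ ≥ a_m ≥ 0}`. … `(ab)_i = min{a_i, b_i}`, `E_1(a) = E(a) = (a_1 + ⋯ + a_m)/m²`,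
> `E_2(a,b) = E(ab) − E(a)E(b)`, `E_3(a,b,c) = 2E(abc) + E(a)E(b)E(c) − E(a)E(bc) − E(b)E(ac) − E(c)E(ab)`."
> "**THEOREM 2.9.** For all `a, b, c` in `𝒜` we have `E_3(a,b,c) ≥ 0`."

(`a ∈ 𝒜(m)` encodes the staircase `S_a = ⋃_{j ≤ a_i} D_{i,j}` of little squares of the `m × m` grid; these are
exactly the monotone unions of little squares, and `E` is the uniform probability measure on the grid.)

## The printed proof and how it is mirrored (same order, same names)

* perturbations of `a` at a descent `a_i > a_{i+1}` [LiebSahi2021, (2.10)]: `a⁻` (`a_i ↦ a_{i+1}`), `a⁺`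
  (`a_{i+1} ↦ a_i`), `a⋆` (`a_{i+1} ↦ a_{i+1} + 1`) — `aMinus`, `aPlus`, `aStar`;
* Lemma 2.4 (`E_2 ≥ 0` by FKG) — `F2_nonneg`, from `Sahi2008/FKG.lean` on the grid lattice `Fin m × Fin m`
  with the uniform weight, through the dictionary `a ↦ S_a` (`stairSet`) and the order-reversing reflection of
  the grid (staircases are DOWN-sets);
* Lemma 2.5 / Proposition 2.6 (`E_3(a⁺,b,c) + E_3(a⁻,b,c) = 2E_3(a,b,c)` when `b, c` have no descent at `i`) —
  `S_aPlus_add_S_aMinus`, `F3_aPlus_add_F3_aMinus`;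
* Lemma 2.7 / Proposition 2.8 (`a⋆b = ab` and `E_3(a⋆,b,c) ≤ E_3(a,b,c)` when `a, b` have descent at `i`,
  `b_{i+1} ≤ a_{i+1}`, via the identity (2.13)) — `aStar_inf_eq`, `F3_sub_F3_aStar`, `F3_aStar_le`;
* Theorem 2.9 (minimise `E_3`, then maximise `E(a)+E(b)+E(c)`; an extremal triple has no descent, hence is
  constant, and for constants `E_3 = α(1−β)(2−γ) ≥ 0`) — `F3_nonneg` (`noDescent_of_extremal`, `F3_const_nonneg`).

To keep the algebra polynomial we work with `S(a) = a_1 + ⋯ + a_m = m²·E(a)` and the scaled functionals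
`F2 = m⁴·E_2`, `F3 = m⁶·E_3` (documented deviation: a normalisation only).  The last part of the file transports
Theorem 2.9 to the tree's `sahiE`: for the uniform probability weight on the grid `Fin m × Fin m` (`m ≥ 1`),
`E_3 ≥ 0` for the indicators of any three down-sets (`sahiE_three_setInd_nonneg_of_isLowerSet_grid`) and — by the
layer cake of `Indicators.lean` and the reflection `(i,j) ↦ (m−1−i, m−1−j)` — **order-3 Sahi positivity of the
uniform weight on the square grid** (`sahiPositive_three_uniformGrid`), i.e. [LiebSahi2021, Thm. 2.1] with
Lebesgue measure on `[0,1]²` replaced by the uniform measure on the `m × m` grid (their Lemma 2.3 is the passage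
between the two; the continuum limit is not formalised).

Everything here is PROVED; no named facts.  Motivation (this programme, crux `stmt-CriticalPhenomena-4575`,
cell prim-sahi): the printed unconditional cases of Sahi's `C_3` — cumulations, chains, `|X| ≤ 2`, and this
two-dimensional one — are all tree theorems.
-/

noncomputable section

namespace Literature.Combinatorics.Sahi2008

namespace LiebSahiGrid

open Finset Function

variable {m : ℕ}

/-! ### Staircase sequences `𝒜(m)` and the scaled functionals -/

/-- `a ∈ 𝒜(m)`: a decreasing `m`-tuple of integers between `0` and `m` (indexed by `Fin m`).
[cite: LiebSahi2021, eq. (2.5)] -/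
def IsStair (m : ℕ) (a : Fin m → ℕ) : Prop := Antitone a ∧ ∀ i, a i ≤ m

/-- `S(a) = a_1 + ⋯ + a_m`, so that Lieb–Sahi's `E(a) = S(a)/m²`. [cite: LiebSahi2021, eq. (2.7)] -/
def S (a : Fin m → ℕ) : ℝ := ∑ i, (a i : ℝ)

/-- `F2(b,c) = m⁴·E_2(b,c) = m²·S(bc) − S(b)S(c)` (`(bc)_i = min{b_i, c_i}`). [cite: LiebSahi2021, eqs. (2.6)–(2.8)] -/
def F2 (m : ℕ) (b c : Fin m → ℕ) : ℝ := (m : ℝ) ^ 2 * S (b ⊓ c) - S b * S c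

/-- `F3(a,b,c) = m⁶·E_3(a,b,c) = 2m⁴S(abc) + S(a)S(b)S(c) − m²[S(a)S(bc) + S(b)S(ac) + S(c)S(ab)]`.
[cite: LiebSahi2021, eq. (2.9)] -/
def F3 (m : ℕ) (a b c : Fin m → ℕ) : ℝ :=
  2 * ((m : ℝ) ^ 2) ^ 2 * S (a ⊓ b ⊓ c) + S a * S b * S c -
    (m : ℝ) ^ 2 * (S a * S (b ⊓ c) + S b * S (a ⊓ c) + S c * S (a ⊓ b))

/-- `S ≥ 0`. [cite: LiebSahi2021, eq. (2.7)] -/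
theorem S_nonneg (a : Fin m → ℕ) : 0 ≤ S a := sum_nonneg fun _ _ => Nat.cast_nonneg _

/-- `S` is monotone in the sequence. [cite: LiebSahi2021, eq. (2.7)] -/
theorem S_mono {a b : Fin m → ℕ} (h : ∀ i, a i ≤ b i) : S a ≤ S b :=
  sum_le_sum fun i _ => by exact_mod_cast h i

/-- `F3` is symmetric: swap of the first two arguments. [cite: LiebSahi2021, eq. (2.9)] -/
theorem F3_swap12 (a b c : Fin m → ℕ) : F3 m a b c = F3 m b a c := by
  simp only [F3, inf_comm a b]
  ring

/-- `F3` is symmetric: swap of the last two arguments. [cite: LiebSahi2021, eq. (2.9)] -/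
theorem F3_swap23 (a b c : Fin m → ℕ) : F3 m a b c = F3 m a c b := by
  simp only [F3, inf_right_comm a b c, inf_comm b c]
  ring

/-- `F3` is symmetric: swap of the outer arguments. [cite: LiebSahi2021, eq. (2.9)] -/
theorem F3_swap13 (a b c : Fin m → ℕ) : F3 m a b c = F3 m c b a := by
  rw [F3_swap12, F3_swap23, F3_swap12]

/-! ### Updating one entry -/

/-- Sum of a slot-dependent function over a sequence with one entry replaced (plumbing). [folklore] -/
private theorem sum_update_eq (a : Fin m → ℕ) (k : Fin m) (v : ℕ) (ψ : Fin m → ℕ → ℝ) :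
    ∑ j, ψ j (update a k v j) = ∑ j, ψ j (a j) + (ψ k v - ψ k (a k)) := by
  have h : ∑ j, (ψ j (update a k v j) - ψ j (a j)) = ψ k v - ψ k (a k) := by
    rw [Finset.sum_eq_single k]
    · rw [update_self]
    · intro j _ hjk
      rw [update_of_ne hjk, sub_self]
    · intro hk
      exact absurd (mem_univ k) hk
  rw [sum_sub_distrib] at h
  linarith

/-- `S` of `(update a k v) ⊓ d`. [folklore] -/
private theorem S_update_inf (a d : Fin m → ℕ) (k : Fin m) (v : ℕ) :
    S (update a k v ⊓ d) = S (a ⊓ d) + (((min v (d k) : ℕ) : ℝ) - ((min (a k) (d k) : ℕ) : ℝ)) := by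
  unfold S
  have h := sum_update_eq a k v (fun j x => ((min x (d j) : ℕ) : ℝ))
  simpa only [Pi.inf_apply] using h

/-- `S` of `update a k v`. [folklore] -/
private theorem S_update (a : Fin m → ℕ) (k : Fin m) (v : ℕ) :
    S (update a k v) = S a + ((v : ℝ) - (a k : ℝ)) := by
  unfold S
  exact sum_update_eq a k v (fun _ x => (x : ℝ))

/-- An antitone sequence stays antitone when one entry is replaced by a value squeezed between its
neighbours' bounds (plumbing for the three perturbations). [folklore] -/
private theorem antitone_update {a : Fin m → ℕ} (ha : Antitone a) (k : Fin m) (v : ℕ)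
    (hlo : ∀ j, k < j → a j ≤ v) (hhi : ∀ j, j < k → v ≤ a j) : Antitone (update a k v) := by
  intro x y hxy
  by_cases hy : y = k
  · subst hy
    rw [update_self]
    by_cases hx : x = y
    · subst hx
      rw [update_self]
    · rw [update_of_ne hx]
      exact hhi x (lt_of_le_of_ne hxy hx)
  · rw [update_of_ne hy]
    by_cases hx : x = k
    · subst hx
      rw [update_self]
      exact hlo y (lt_of_le_of_ne hxy (Ne.symm hy))
    · rw [update_of_ne hx]
      exact ha hxy

/-! ### Descents and the perturbations `a⁻, a⁺, a⋆` [LiebSahi2021, (2.10)] -/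

/-- The position `i` (as an element of `Fin m`, given `i + 1 < m`). [cite: LiebSahi2021, eq. (2.10)] -/
def ixL {i : ℕ} (hi : i + 1 < m) : Fin m := ⟨i, by omega⟩

/-- The position `i + 1`. [cite: LiebSahi2021, eq. (2.10)] -/
def ixR {i : ℕ} (hi : i + 1 < m) : Fin m := ⟨i + 1, hi⟩

/-- `i < i + 1` as positions. [folklore] -/
private theorem ixL_lt_ixR {i : ℕ} (hi : i + 1 < m) : ixL hi < ixR hi :=
  Fin.mk_lt_mk.2 (Nat.lt_succ_self i)

/-- "`a` has descent at `i`": `a_i > a_{i+1}`. [cite: LiebSahi2021, before eq. (2.10)] -/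
def HasDescent (a : Fin m → ℕ) {i : ℕ} (hi : i + 1 < m) : Prop := a (ixR hi) < a (ixL hi)

/-- No descent at `i` for a decreasing sequence means `a_i = a_{i+1}`. [cite: LiebSahi2021, Lemma 2.5 (proof)] -/
theorem eq_of_not_hasDescent {a : Fin m → ℕ} (ha : Antitone a) {i : ℕ} (hi : i + 1 < m)
    (h : ¬ HasDescent a hi) : a (ixL hi) = a (ixR hi) :=
  le_antisymm (not_lt.1 h) (ha (ixL_lt_ixR hi).le)

/-- `a⁻`: `a_i` lowered to `a_{i+1}`. [cite: LiebSahi2021, eq. (2.10)] -/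
def aMinus (a : Fin m → ℕ) {i : ℕ} (hi : i + 1 < m) : Fin m → ℕ := update a (ixL hi) (a (ixR hi))

/-- `a⁺`: `a_{i+1}` raised to `a_i`. [cite: LiebSahi2021, eq. (2.10)] -/
def aPlus (a : Fin m → ℕ) {i : ℕ} (hi : i + 1 < m) : Fin m → ℕ := update a (ixR hi) (a (ixL hi))

/-- `a⋆`: `a_{i+1}` raised by one. [cite: LiebSahi2021, eq. (2.10)] -/
def aStar (a : Fin m → ℕ) {i : ℕ} (hi : i + 1 < m) : Fin m → ℕ := update a (ixR hi) (a (ixR hi) + 1)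

section Perturb

variable {a : Fin m → ℕ} {i : ℕ} (hi : i + 1 < m)

/-- `a⁻ ∈ 𝒜(m)`. [cite: LiebSahi2021, after eq. (2.10)] -/
theorem isStair_aMinus (ha : IsStair m a) : IsStair m (aMinus a hi) := by
  refine ⟨antitone_update ha.1 _ _ (fun j hj => ha.1 ?_) (fun j hj => ?_), fun j => ?_⟩
  · exact Nat.succ_le_of_lt (Fin.lt_def.1 hj)
  · exact (ha.1 (ixL_lt_ixR hi).le).trans (ha.1 hj.le)
  · unfold aMinus
    by_cases hj : j = ixL hi
    · subst hj; rw [update_self]; exact ha.2 _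
    · rw [update_of_ne hj]; exact ha.2 _

/-- `a⁺ ∈ 𝒜(m)`. [cite: LiebSahi2021, after eq. (2.10)] -/
theorem isStair_aPlus (ha : IsStair m a) : IsStair m (aPlus a hi) := by
  refine ⟨antitone_update ha.1 _ _ (fun j hj => ?_) (fun j hj => ha.1 ?_), fun j => ?_⟩
  · exact (ha.1 hj.le).trans (ha.1 (ixL_lt_ixR hi).le)
  · exact Nat.le_of_lt_succ (Fin.lt_def.1 hj)
  · unfold aPlus
    by_cases hj : j = ixR hi
    · subst hj; rw [update_self]; exact ha.2 _
    · rw [update_of_ne hj]; exact ha.2 _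

/-- `a⋆ ∈ 𝒜(m)` when `a` has descent at `i`. [cite: LiebSahi2021, after eq. (2.10)] -/
theorem isStair_aStar (ha : IsStair m a) (hd : HasDescent a hi) : IsStair m (aStar a hi) := by
  have hd' : a (ixR hi) + 1 ≤ a (ixL hi) := Nat.succ_le_of_lt hd
  refine ⟨antitone_update ha.1 _ _ (fun j hj => ?_) (fun j hj => ?_), fun j => ?_⟩
  · exact (ha.1 hj.le).trans (Nat.le_succ _)
  · exact hd'.trans (ha.1 (Nat.le_of_lt_succ (Fin.lt_def.1 hj)))
  · unfold aStar
    by_cases hj : j = ixR hi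
    · subst hj; rw [update_self]; exact hd'.trans (ha.2 _)
    · rw [update_of_ne hj]; exact ha.2 _

/-- `S(a⁺) = S(a) + (a_i − a_{i+1})`. [cite: LiebSahi2021, Lemma 2.5 (proof)] -/
theorem S_aPlus : S (aPlus a hi) = S a + ((a (ixL hi) : ℝ) - (a (ixR hi) : ℝ)) :=
  S_update a _ _

/-- `S(a⁻) = S(a) − (a_i − a_{i+1})`. [cite: LiebSahi2021, Lemma 2.5 (proof)] -/
theorem S_aMinus : S (aMinus a hi) = S a + ((a (ixR hi) : ℝ) - (a (ixL hi) : ℝ)) :=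
  S_update a _ _

/-- `S(a⋆) = S(a) + 1`. [cite: LiebSahi2021, Prop. 2.8 (proof: E(a⋆) ≥ E(a))] -/
theorem S_aStar : S (aStar a hi) = S a + 1 := by
  rw [aStar, S_update]
  push_cast
  ring

/-- **Lemma 2.5**: if `a` has descent at `i` but `d` does not (`d_i = d_{i+1}`), then
`S(a⁺d) + S(a⁻d) = 2S(ad)`. [cite: LiebSahi2021, Lemma 2.5] -/
theorem S_aPlus_add_S_aMinus {d : Fin m → ℕ} (hd : d (ixL hi) = d (ixR hi)) :
    S (aPlus a hi ⊓ d) + S (aMinus a hi ⊓ d) = 2 * S (a ⊓ d) := by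
  rw [aPlus, aMinus, S_update_inf, S_update_inf, hd]
  ring

/-- The same without a partner: `S(a⁺) + S(a⁻) = 2S(a)`. [cite: LiebSahi2021, Lemma 2.5] -/
theorem S_aPlus_add_S_aMinus' : S (aPlus a hi) + S (aMinus a hi) = 2 * S a := by
  rw [S_aPlus, S_aMinus]
  ring

/-- **Proposition 2.6** (scaled): if `a` has descent at `i` but `b, c` do not, then
`F3(a⁺,b,c) + F3(a⁻,b,c) = 2F3(a,b,c)`. [cite: LiebSahi2021, Prop. 2.6] -/
theorem F3_aPlus_add_F3_aMinus {b c : Fin m → ℕ} (hb : b (ixL hi) = b (ixR hi))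
    (hc : c (ixL hi) = c (ixR hi)) :
    F3 m (aPlus a hi) b c + F3 m (aMinus a hi) b c = 2 * F3 m a b c := by
  have hbc : (b ⊓ c) (ixL hi) = (b ⊓ c) (ixR hi) := by
    simp only [Pi.inf_apply, hb, hc]
  have h1 := S_aPlus_add_S_aMinus hi (a := a) hbc
  have h2 := S_aPlus_add_S_aMinus hi (a := a) hb
  have h3 := S_aPlus_add_S_aMinus hi (a := a) hc
  have h4 := S_aPlus_add_S_aMinus' hi (a := a)
  simp only [F3, inf_assoc]
  linear_combination (2 * ((m : ℝ) ^ 2) ^ 2) * h1 + (S b * S c - (m : ℝ) ^ 2 * S (b ⊓ c)) * h4 -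
    (m : ℝ) ^ 2 * S b * h3 - (m : ℝ) ^ 2 * S c * h2

/-- **Lemma 2.7**: if `a, b` have descent at `i` and `b_{i+1} ≤ a_{i+1}` then `a⋆b = ab`.
[cite: LiebSahi2021, Lemma 2.7] -/
theorem aStar_inf_eq {b : Fin m → ℕ} (hle : b (ixR hi) ≤ a (ixR hi)) : aStar a hi ⊓ b = a ⊓ b := by
  funext j
  simp only [Pi.inf_apply, aStar]
  by_cases hj : j = ixR hi
  · subst hj
    rw [update_self]
    rw [min_eq_right (hle.trans (Nat.le_succ _)), min_eq_right hle]
  · rw [update_of_ne hj]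

/-- `a⋆ ≥ a` entrywise, hence `S(a⋆c) ≥ S(ac)`. [cite: LiebSahi2021, Prop. 2.8 (proof)] -/
theorem S_inf_le_S_aStar_inf (c : Fin m → ℕ) : S (a ⊓ c) ≤ S (aStar a hi ⊓ c) := by
  refine S_mono fun j => ?_
  simp only [Pi.inf_apply, aStar]
  by_cases hj : j = ixR hi
  · subst hj
    rw [update_self]
    exact inf_le_inf_right _ (Nat.le_succ _)
  · rw [update_of_ne hj]

/-- **The identity (2.13)** (scaled): if `a, b` have descent at `i` and `b_{i+1} ≤ a_{i+1}`, then
`F3(a,b,c) − F3(a⋆,b,c) = F2(b,c)·[S(a⋆) − S(a)] + m²·S(b)·[S(a⋆c) − S(ac)]`.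
[cite: LiebSahi2021, Prop. 2.8, eq. (2.13)] -/
theorem F3_sub_F3_aStar {b : Fin m → ℕ} (hle : b (ixR hi) ≤ a (ixR hi)) (c : Fin m → ℕ) :
    F3 m a b c - F3 m (aStar a hi) b c =
      F2 m b c * (S (aStar a hi) - S a) + (m : ℝ) ^ 2 * S b * (S (aStar a hi ⊓ c) - S (a ⊓ c)) := by
  have h1 : S (aStar a hi ⊓ b) = S (a ⊓ b) := by rw [aStar_inf_eq hi hle]
  have h2 : S (aStar a hi ⊓ b ⊓ c) = S (a ⊓ b ⊓ c) := by rw [aStar_inf_eq hi hle]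
  simp only [F3, F2, h1, h2]
  ring

/-- **Proposition 2.8** (scaled): under the same hypotheses, and given `E_2(b,c) ≥ 0` (Lemma 2.4),
`F3(a⋆,b,c) ≤ F3(a,b,c)`. [cite: LiebSahi2021, Prop. 2.8] -/
theorem F3_aStar_le {b : Fin m → ℕ} (hle : b (ixR hi) ≤ a (ixR hi)) (c : Fin m → ℕ)
    (hF2 : 0 ≤ F2 m b c) : F3 m (aStar a hi) b c ≤ F3 m a b c := by
  have h := F3_sub_F3_aStar hi hle c
  have h1 : 0 ≤ S (aStar a hi) - S a := by rw [S_aStar]; linarith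
  have h2 : 0 ≤ S (aStar a hi ⊓ c) - S (a ⊓ c) := sub_nonneg.2 (S_inf_le_S_aStar_inf hi c)
  have h3 : 0 ≤ (m : ℝ) ^ 2 * S b := by have := S_nonneg b; positivity
  nlinarith [mul_nonneg hF2 h1, mul_nonneg h3 h2]

end Perturb

/-! ### Constant sequences -/

/-- A decreasing sequence without descents is constant. [cite: LiebSahi2021, Thm. 2.9 (proof)] -/
theorem eq_const_of_forall_not_hasDescent (hm : 0 < m) {a : Fin m → ℕ} (ha : Antitone a)
    (h : ∀ (i : ℕ) (hi : i + 1 < m), ¬ HasDescent a hi) : a = fun _ => a ⟨0, hm⟩ := by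
  funext j
  obtain ⟨j, hj⟩ := j
  induction j with
  | zero => rfl
  | succ j ih =>
    have hj' : j < m := by omega
    rw [← ih hj']
    exact (eq_of_not_hasDescent ha hj (h j hj)).symm

/-- The constant-case function `g(x,y,z) = 2M²·min(x,y,z) + xyz − M(x·min(y,z) + y·min(x,z) + z·min(x,y))`
(`= M³·E_3` for constant sequences `x, y, z` on the `M × M` grid; plumbing). [folklore] -/
private def g (M x y z : ℝ) : ℝ :=
  2 * M ^ 2 * min (min x y) z + x * y * z - M * (x * min y z + y * min x z + z * min x y)

/-- `g` is symmetric in its first two arguments. [folklore] -/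
private theorem g_swap12 (M x y z : ℝ) : g M x y z = g M y x z := by
  unfold g
  rw [min_comm x y]
  ring

/-- `g` is symmetric in its last two arguments. [folklore] -/
private theorem g_swap23 (M x y z : ℝ) : g M x y z = g M x z y := by
  unfold g
  rw [min_right_comm x y z, min_comm y z]
  ring

/-- Sorted case: `g = x(M − y)(2M − z) ≥ 0` for `0 ≤ x ≤ y ≤ z ≤ M` — Lieb–Sahi's `α(1−β)(2−γ) ≥ 0`.
[cite: LiebSahi2021, Thm. 2.9 (end of proof)] -/
private theorem g_sorted_nonneg {M x y z : ℝ} (hx : 0 ≤ x) (hxy : x ≤ y) (hyz : y ≤ z) (hzM : z ≤ M) :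
    0 ≤ g M x y z := by
  unfold g
  rw [min_eq_left hxy, min_eq_left (hxy.trans hyz), min_eq_left hyz]
  have h : 2 * M ^ 2 * x + x * y * z - M * (x * y + y * x + z * x) = x * (M - y) * (2 * M - z) := by ring
  rw [h]
  have h1 : 0 ≤ M - y := by linarith
  have h2 : 0 ≤ 2 * M - z := by linarith
  positivity

/-- All orderings. [cite: LiebSahi2021, Thm. 2.9 (end of proof, "by symmetry")] -/
private theorem g_nonneg {M x y z : ℝ} (hx : 0 ≤ x) (hy : 0 ≤ y) (hz : 0 ≤ z) (hxM : x ≤ M)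
    (hyM : y ≤ M) (hzM : z ≤ M) : 0 ≤ g M x y z := by
  rcases le_total x y with hxy | hyx
  · rcases le_total y z with hyz | hzy
    · exact g_sorted_nonneg hx hxy hyz hzM
    · rcases le_total x z with hxz | hzx
      · rw [g_swap23]
        exact g_sorted_nonneg hx hxz hzy hyM
      · rw [g_swap23, g_swap12]
        exact g_sorted_nonneg hz hzx hxy hyM
  · rcases le_total x z with hxz | hzx
    · rw [g_swap12]
      exact g_sorted_nonneg hy hyx hxz hzM
    · rcases le_total y z with hyz | hzy
      · rw [g_swap12, g_swap23]
        exact g_sorted_nonneg hy hyz hzx hxM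
      · rw [g_swap23, g_swap12, g_swap23]
        exact g_sorted_nonneg hz hzy hyx hxM

/-- `F3 ≥ 0` on constant sequences in `[0, m]`: `F3 = m³·g(m; x, y, z)`, i.e. `E_3 = α(1−β)(2−γ) ≥ 0` after
sorting. [cite: LiebSahi2021, Thm. 2.9 (end of proof)] -/
theorem F3_const_nonneg {x y z : ℕ} (hx : x ≤ m) (hy : y ≤ m) (hz : z ≤ m) :
    0 ≤ F3 m (fun _ => x) (fun _ => y) (fun _ => z) := by
  have hS : ∀ w : ℕ, S (fun _ : Fin m => w) = (m : ℝ) * w := fun w => by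
    simp [S, sum_const, card_univ, Fintype.card_fin]
  have hinf2 : ∀ u v : ℕ, ((fun _ : Fin m => u) ⊓ fun _ => v) = fun _ => min u v := fun u v => rfl
  simp only [F3, hinf2, hS]
  push_cast
  have key : 2 * ((m : ℝ) ^ 2) ^ 2 * ((m : ℝ) * min (min (x : ℝ) y) z) +
      (m : ℝ) * x * ((m : ℝ) * y) * ((m : ℝ) * z) -
      (m : ℝ) ^ 2 * ((m : ℝ) * x * ((m : ℝ) * min (y : ℝ) z) + (m : ℝ) * y * ((m : ℝ) * min (x : ℝ) z) +
        (m : ℝ) * z * ((m : ℝ) * min (x : ℝ) y)) = (m : ℝ) ^ 3 * g m x y z := by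
    unfold g
    ring
  rw [key]
  have hg := g_nonneg (M := (m : ℝ)) (x := x) (y := y) (z := z) (Nat.cast_nonneg _) (Nat.cast_nonneg _)
    (Nat.cast_nonneg _) (by exact_mod_cast hx) (by exact_mod_cast hy) (by exact_mod_cast hz)
  positivity

/-! ### Theorem 2.9: the extremal argument -/

open Classical in
/-- `𝒜(m)` as a finite set (plumbing for the extremal argument). [folklore] -/
private def stairs (m : ℕ) : Finset (Fin m → ℕ) :=
  (Fintype.piFinset fun _ : Fin m => Finset.range (m + 1)).filter (IsStair m)

open Classical in
/-- Membership in `stairs m`. [folklore] -/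
private theorem mem_stairs {a : Fin m → ℕ} : a ∈ stairs m ↔ IsStair m a := by
  unfold stairs
  rw [Finset.mem_filter, Fintype.mem_piFinset]
  constructor
  · exact fun h => h.2
  · exact fun h => ⟨fun i => Finset.mem_range.2 (Nat.lt_succ_of_le (h.2 i)), h⟩

/-- The heart of [LiebSahi2021, Thm. 2.9]: if `(a,b,c)` minimises `E_3` over `𝒜³` and, among the minimisers,
maximises `E(a)+E(b)+E(c)`, then `a` has no descent — otherwise `a⁺` (Prop. 2.6) or a starred sequence
(Prop. 2.8) is again a minimiser with a larger sum. [cite: LiebSahi2021, Thm. 2.9 (proof)] -/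
private theorem not_hasDescent_of_extremal
    (hF2 : ∀ b c, IsStair m b → IsStair m c → 0 ≤ F2 m b c)
    {a b c : Fin m → ℕ} (ha : IsStair m a) (hb : IsStair m b) (hc : IsStair m c)
    (hmin : ∀ a' b' c', IsStair m a' → IsStair m b' → IsStair m c' → F3 m a b c ≤ F3 m a' b' c')
    (hmax : ∀ a' b' c', IsStair m a' → IsStair m b' → IsStair m c' → F3 m a' b' c' = F3 m a b c →
      S a' + S b' + S c' ≤ S a + S b + S c)
    {i : ℕ} (hi : i + 1 < m) : ¬ HasDescent a hi := by
  intro hd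
  by_cases hbd : HasDescent b hi
  · -- `b` also has descent at `i`: star the sequence with the larger `(i+1)`-entry [Prop. 2.8]
    rcases le_total (b (ixR hi)) (a (ixR hi)) with hle | hle
    · have hst := isStair_aStar hi ha hd
      have h1 := F3_aStar_le hi hle c (hF2 b c hb hc)
      have h2 := hmin _ _ _ hst hb hc
      have h3 := hmax _ _ _ hst hb hc (le_antisymm h1 h2)
      rw [S_aStar] at h3
      linarith
    · have hst := isStair_aStar hi hb hbd
      have h1 := F3_aStar_le hi hle c (hF2 a c ha hc)
      rw [← F3_swap12 a (aStar b hi) c, ← F3_swap12 a b c] at h1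
      have h2 := hmin _ _ _ ha hst hc
      have h3 := hmax _ _ _ ha hst hc (le_antisymm h1 h2)
      rw [S_aStar] at h3
      linarith
  · by_cases hcd : HasDescent c hi
    · -- `c` has descent at `i` (and `b` does not): the same with `c` [Prop. 2.8]
      rcases le_total (c (ixR hi)) (a (ixR hi)) with hle | hle
      · have hst := isStair_aStar hi ha hd
        have h1 := F3_aStar_le hi hle b (hF2 c b hc hb)
        rw [← F3_swap23 (aStar a hi) b c, ← F3_swap23 a b c] at h1
        have h2 := hmin _ _ _ hst hb hc
        have h3 := hmax _ _ _ hst hb hc (le_antisymm h1 h2)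
        rw [S_aStar] at h3
        linarith
      · have hst := isStair_aStar hi hc hcd
        have h1 := F3_aStar_le hi hle b (hF2 a b ha hb)
        rw [← F3_swap13 b a (aStar c hi), ← F3_swap12 a b (aStar c hi), ← F3_swap13 b a c,
          ← F3_swap12 a b c] at h1
        have h2 := hmin _ _ _ ha hb hst
        have h3 := hmax _ _ _ ha hb hst (le_antisymm h1 h2)
        rw [S_aStar] at h3
        linarith
    · -- neither `b` nor `c` has descent at `i` [Prop. 2.6]
      have hbflat := eq_of_not_hasDescent hb.1 hi hbd
      have hcflat := eq_of_not_hasDescent hc.1 hi hcd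
      have h26 := F3_aPlus_add_F3_aMinus hi (a := a) hbflat hcflat
      have hP := hmin _ _ _ (isStair_aPlus hi ha) hb hc
      have hM := hmin _ _ _ (isStair_aMinus hi ha) hb hc
      have heq : F3 m (aPlus a hi) b c = F3 m a b c := by linarith
      have h3 := hmax _ _ _ (isStair_aPlus hi ha) hb hc heq
      rw [S_aPlus] at h3
      have hd' : (a (ixR hi) : ℝ) < a (ixL hi) := by exact_mod_cast hd
      linarith

/-- **Theorem 2.9** (scaled form), given Lemma 2.4 (`E_2 ≥ 0` on `𝒜`) as input: `F3(a,b,c) ≥ 0` for all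
`a, b, c ∈ 𝒜(m)`.  Proof as printed: minimise `E_3`, maximise the sum among minimisers, conclude that the
extremal triple is constant, and use `α(1−β)(2−γ) ≥ 0`.  (Lemma 2.4 is supplied below from the FKG inequality
on the grid, `F2_nonneg`; the unconditional statement is `F3_nonneg`.) [cite: LiebSahi2021, Thm. 2.9] -/
theorem F3_nonneg_of_F2 (hF2 : ∀ b c, IsStair m b → IsStair m c → 0 ≤ F2 m b c) {a b c : Fin m → ℕ}
    (ha : IsStair m a) (hb : IsStair m b) (hc : IsStair m c) : 0 ≤ F3 m a b c := by
  classical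
  rcases Nat.eq_zero_or_pos m with hm | hm
  · subst hm
    simp [F3, S]
  set T : Finset ((Fin m → ℕ) × (Fin m → ℕ) × (Fin m → ℕ)) := stairs m ×ˢ (stairs m ×ˢ stairs m)
    with hT
  have hmemT : ∀ {x y z : Fin m → ℕ}, (x, y, z) ∈ T ↔ IsStair m x ∧ IsStair m y ∧ IsStair m z := by
    intro x y z
    simp only [hT, Finset.mem_product, mem_stairs]
  have hne : T.Nonempty := ⟨(a, b, c), hmemT.2 ⟨ha, hb, hc⟩⟩
  obtain ⟨t₀, ht₀, hmin⟩ := T.exists_min_image (fun t => F3 m t.1 t.2.1 t.2.2) hne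
  set T' := T.filter (fun t => F3 m t.1 t.2.1 t.2.2 = F3 m t₀.1 t₀.2.1 t₀.2.2) with hT'
  have hne' : T'.Nonempty := ⟨t₀, by rw [hT', Finset.mem_filter]; exact ⟨ht₀, rfl⟩⟩
  obtain ⟨⟨a₁, b₁, c₁⟩, ht₁, hmax⟩ := T'.exists_max_image (fun t => S t.1 + S t.2.1 + S t.2.2) hne'
  rw [hT', Finset.mem_filter] at ht₁
  obtain ⟨ht₁T, ht₁eq⟩ := ht₁
  have ht₁eq' : F3 m a₁ b₁ c₁ = F3 m t₀.1 t₀.2.1 t₀.2.2 := ht₁eq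
  obtain ⟨ha₁, hb₁, hc₁⟩ := hmemT.1 ht₁T
  -- extremality, unfolded
  have hmin₁ : ∀ a' b' c', IsStair m a' → IsStair m b' → IsStair m c' →
      F3 m a₁ b₁ c₁ ≤ F3 m a' b' c' := by
    intro a' b' c' ha' hb' hc'
    have h := hmin (a', b', c') (hmemT.2 ⟨ha', hb', hc'⟩)
    rw [ht₁eq']
    exact h
  have hmax₁ : ∀ a' b' c', IsStair m a' → IsStair m b' → IsStair m c' → F3 m a' b' c' = F3 m a₁ b₁ c₁ →
      S a' + S b' + S c' ≤ S a₁ + S b₁ + S c₁ := by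
    intro a' b' c' ha' hb' hc' heq
    have hmem' : (a', b', c') ∈ T' := by
      rw [hT', Finset.mem_filter]
      exact ⟨hmemT.2 ⟨ha', hb', hc'⟩, heq.trans ht₁eq'⟩
    exact hmax _ hmem'
  -- no component of the extremal triple has a descent
  have hda : ∀ (i : ℕ) (hi : i + 1 < m), ¬ HasDescent a₁ hi := fun i hi =>
    not_hasDescent_of_extremal hF2 ha₁ hb₁ hc₁ hmin₁ hmax₁ hi
  have hdb : ∀ (i : ℕ) (hi : i + 1 < m), ¬ HasDescent b₁ hi := fun i hi =>
    not_hasDescent_of_extremal hF2 hb₁ ha₁ hc₁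
      (fun a' b' c' ha' hb' hc' => by
        rw [← F3_swap12 a₁ b₁ c₁]
        exact hmin₁ a' b' c' ha' hb' hc')
      (fun a' b' c' ha' hb' hc' heq => by
        have h := hmax₁ a' b' c' ha' hb' hc' (heq.trans (F3_swap12 b₁ a₁ c₁))
        linarith) hi
  have hdc : ∀ (i : ℕ) (hi : i + 1 < m), ¬ HasDescent c₁ hi := fun i hi =>
    not_hasDescent_of_extremal hF2 hc₁ hb₁ ha₁
      (fun a' b' c' ha' hb' hc' => by
        rw [← F3_swap13 a₁ b₁ c₁]
        exact hmin₁ a' b' c' ha' hb' hc')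
      (fun a' b' c' ha' hb' hc' heq => by
        have h := hmax₁ a' b' c' ha' hb' hc' (heq.trans (F3_swap13 c₁ b₁ a₁))
        linarith) hi
  -- hence all three are constant, and `E_3 ≥ 0` there
  have ea := eq_const_of_forall_not_hasDescent hm ha₁.1 hda
  have eb := eq_const_of_forall_not_hasDescent hm hb₁.1 hdb
  have ec := eq_const_of_forall_not_hasDescent hm hc₁.1 hdc
  have hpos : 0 ≤ F3 m a₁ b₁ c₁ := by
    rw [ea, eb, ec]
    exact F3_const_nonneg (ha₁.2 _) (hb₁.2 _) (hc₁.2 _)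
  exact hpos.trans (hmin₁ a b c ha hb hc)

/-! ### The grid `Fin m × Fin m`: uniform weight, staircases as down-sets, and Lemma 2.4 -/

/-- The uniform probability weight on the `m × m` grid (Lieb–Sahi's `E` on unions of little squares).
[cite: LiebSahi2021, eq. (2.7) and Lemma 2.3] -/
def gridWeight (m : ℕ) : Fin m × Fin m → ℝ := fun _ => 1 / (m : ℝ) ^ 2

/-- The uniform weight on the grid is an FKG probability weight (the lattice condition holds with equality).
[cite: LiebSahi2021, §1 (FKG poset) and Lemma 2.4] -/
theorem isFKGMeasure_gridWeight (hm : 0 < m) : IsFKGMeasure (gridWeight m) where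
  nonneg _ := by unfold gridWeight; positivity
  sum_eq_one := by
    simp only [gridWeight, sum_const, card_univ, Fintype.card_prod, Fintype.card_fin, nsmul_eq_mul,
      Nat.cast_mul]
    have : (m : ℝ) ≠ 0 := by exact_mod_cast hm.ne'
    rw [← sq, one_div, mul_inv_cancel₀ (pow_ne_zero 2 this)]
  mul_le_mul _ _ := le_rfl

/-- The staircase `S_a = {(i, j) : j < a_i}` of the sequence `a` (Lieb–Sahi's `⋃_{j ≤ a_i} D_{i,j}`, little squares
indexed from `0`). [cite: LiebSahi2021, eq. (2.6)] -/
def stairSet (a : Fin m → ℕ) : Finset (Fin m × Fin m) := univ.filter fun p => (p.2 : ℕ) < a p.1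

/-- Membership in `S_a`. [cite: LiebSahi2021, eq. (2.6)] -/
theorem mem_stairSet {a : Fin m → ℕ} {p : Fin m × Fin m} : p ∈ stairSet a ↔ (p.2 : ℕ) < a p.1 := by
  simp [stairSet]

/-- `S_{ab} = S_a ∩ S_b` ("`χ_{ab} = χ_a χ_b`"). [cite: LiebSahi2021, §2.1 (after eq. (2.9))] -/
theorem stairSet_inf (a b : Fin m → ℕ) : stairSet (a ⊓ b) = stairSet a ∩ stairSet b := by
  ext p
  simp only [mem_stairSet, Finset.mem_inter, Pi.inf_apply, lt_inf_iff]

/-- `|S_a| = a_1 + ⋯ + a_m` for `a` bounded by `m`. [cite: LiebSahi2021, eq. (2.7)] -/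
theorem card_stairSet {a : Fin m → ℕ} (ha : ∀ i, a i ≤ m) : (stairSet a).card = ∑ i, a i := by
  unfold stairSet
  rw [Finset.card_filter, Fintype.sum_prod_type]
  refine Finset.sum_congr rfl fun i _ => ?_
  have h : (univ.filter fun j : Fin m => (j : ℕ) < a i).card = a i := by
    rw [Fin.card_filter_val_lt, min_eq_right (ha i)]
  rw [← h, Finset.card_filter]

/-- `S_a` is a down-set of the grid when `a` is decreasing. [cite: LiebSahi2021, after eq. (2.6)] -/
theorem isLowerSet_stairSet {a : Fin m → ℕ} (ha : Antitone a) :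
    IsLowerSet ((stairSet a : Finset (Fin m × Fin m)) : Set (Fin m × Fin m)) := by
  intro p q hqp hp
  rw [Finset.mem_coe, mem_stairSet] at hp ⊢
  have h2 : (q.2 : ℕ) ≤ p.2 := hqp.2
  exact lt_of_le_of_lt h2 (lt_of_lt_of_le hp (ha hqp.1))

/-- "Conversely any monotone union of `D_{i,j}` is of this form": every down-set of the grid is `S_a` for some
`a ∈ 𝒜(m)` (`a_i` = the height of column `i`). [cite: LiebSahi2021, after eq. (2.6)] -/
theorem exists_stair_eq_of_isLowerSet (L : Finset (Fin m × Fin m))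
    (hL : IsLowerSet ((L : Finset (Fin m × Fin m)) : Set (Fin m × Fin m))) :
    ∃ a, IsStair m a ∧ stairSet a = L := by
  classical
  refine ⟨fun i => (univ.filter fun j : Fin m => (i, j) ∈ L).card, ⟨?_, ?_⟩, ?_⟩
  · intro i i' hii'
    refine Finset.card_le_card fun j hj => ?_
    rw [Finset.mem_filter] at hj ⊢
    exact ⟨mem_univ _, hL (show ((i, j) : Fin m × Fin m) ≤ (i', j) from ⟨hii', le_rfl⟩) hj.2⟩
  · intro i
    exact (Finset.card_le_univ _).trans (by rw [Fintype.card_fin])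
  · ext ⟨i, j⟩
    rw [mem_stairSet]
    constructor
    · intro hlt
      by_contra hnot
      have hsub : (univ.filter fun j' : Fin m => (i, j') ∈ L) ⊆
          univ.filter fun j' : Fin m => (j' : ℕ) < j := by
        intro j' hj'
        rw [Finset.mem_filter] at hj' ⊢
        refine ⟨mem_univ _, ?_⟩
        by_contra hge
        have hle : j ≤ j' := not_lt.1 hge
        exact hnot (hL (show ((i, j) : Fin m × Fin m) ≤ (i, j') from ⟨le_rfl, hle⟩) hj'.2)
      have hcard := Finset.card_le_card hsub
      rw [Fin.card_filter_val_lt, min_eq_right j.isLt.le] at hcard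
      exact absurd hlt (not_lt.2 hcard)
    · intro hmem
      have hsub : (univ.filter fun j' : Fin m => (j' : ℕ) < (j : ℕ) + 1) ⊆
          univ.filter fun j' : Fin m => (i, j') ∈ L := by
        intro j' hj'
        rw [Finset.mem_filter] at hj' ⊢
        have hle : j' ≤ j := Nat.lt_succ_iff.1 hj'.2
        exact ⟨mem_univ _, hL (show ((i, j') : Fin m × Fin m) ≤ (i, j) from ⟨le_rfl, hle⟩) hmem⟩
      have hcard := Finset.card_le_card hsub
      rw [Fin.card_filter_val_lt, min_eq_right (Nat.succ_le_of_lt j.isLt)] at hcard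
      exact Nat.lt_of_succ_le hcard

/-- `E(χ_A) = |A|/m²` under the uniform weight. [cite: LiebSahi2021, eq. (2.7)] -/
theorem ex_gridWeight_setInd (A : Finset (Fin m × Fin m)) :
    ex (gridWeight m) (setInd A) = (A.card : ℝ) / (m : ℝ) ^ 2 := by
  simp only [ex, gridWeight, setInd_apply, mul_ite, mul_one, mul_zero, Finset.sum_ite_mem, Finset.univ_inter,
    Finset.sum_const, nsmul_eq_mul]
  ring

/-- `E(χ_{S_a}) = S(a)/m² = E(a)`. [cite: LiebSahi2021, eq. (2.7)] -/
theorem ex_setInd_stairSet {a : Fin m → ℕ} (ha : ∀ i, a i ≤ m) :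
    ex (gridWeight m) (setInd (stairSet a)) = S a / (m : ℝ) ^ 2 := by
  rw [ex_gridWeight_setInd, card_stairSet ha, S]
  push_cast
  rfl

/-- The order-reversing reflection `(i, j) ↦ (m−1−i, m−1−j)` of the grid (Lieb–Sahi's change of variables
`x_i ↦ 1 − x_i` exchanging increasing and decreasing). [cite: LiebSahi2021, §2 (before Thm. 2.1)] -/
def gridRev (m : ℕ) : Fin m × Fin m ≃ Fin m × Fin m := Equiv.prodCongr Fin.revPerm Fin.revPerm

/-- The reflection is antitone. [cite: LiebSahi2021, §2 (before Thm. 2.1)] -/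
theorem gridRev_antitone : Antitone (gridRev m) := by
  intro p q hpq
  exact ⟨Fin.rev_le_rev.2 hpq.1, Fin.rev_le_rev.2 hpq.2⟩

/-- The uniform weight is invariant under the reflection: `E(f ∘ rev) = E(f)`. [cite: LiebSahi2021, §2 (before Thm. 2.1)] -/
theorem ex_comp_gridRev (f : Fin m × Fin m → ℝ) : ex (gridWeight m) (f ∘ gridRev m) = ex (gridWeight m) f := by
  unfold ex gridWeight
  exact Equiv.sum_comp (gridRev m) (fun x => 1 / (m : ℝ) ^ 2 * f x)

/-- **FKG for decreasing functions on the grid** (the form Lieb–Sahi use: "FKG and our theorems for decreasing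
functions are equivalent to the corresponding results for increasing functions … by the change of variables
`x_i ↦ 1 − x_i`"). [cite: LiebSahi2021, §2 (before Thm. 2.1) and Lemma 2.4] -/
theorem ex_mul_ex_le_ex_mul_of_antitone (hm : 0 < m) {f g : Fin m × Fin m → ℝ} (hf : ∀ x, 0 ≤ f x)
    (hg : ∀ x, 0 ≤ g x) (hfa : Antitone f) (hga : Antitone g) :
    ex (gridWeight m) f * ex (gridWeight m) g ≤ ex (gridWeight m) (f * g) := by
  have h := ex_mul_ex_le_ex_mul (isFKGMeasure_gridWeight hm) (f := f ∘ gridRev m) (g := g ∘ gridRev m)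
    (fun x => hf _) (fun x => hg _) (hfa.comp gridRev_antitone) (hga.comp gridRev_antitone)
  have hfg : (f ∘ gridRev m) * (g ∘ gridRev m) = (f * g) ∘ gridRev m := rfl
  rwa [hfg, ex_comp_gridRev, ex_comp_gridRev, ex_comp_gridRev] at h

/-- The indicator of a down-set is decreasing. [cite: LiebSahi2021, §2 (monotone sets S ↔ χ_S monotone)] -/
theorem antitone_setInd_of_isLowerSet {β : Type*} [Preorder β] [DecidableEq β] {L : Finset β}
    (hL : IsLowerSet ((L : Finset β) : Set β)) : Antitone (setInd L) := by
  intro x y hxy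
  by_cases hy : y ∈ L
  · have hx : x ∈ L := hL hxy hy
    simp [setInd_apply, hx, hy]
  · by_cases hx : x ∈ L <;> simp [setInd_apply, hx, hy]

/-- **Lemma 2.4** (scaled): `F2(b, c) = m⁴·E_2(b,c) ≥ 0` for `b, c ∈ 𝒜(m)` — the FKG inequality for the two
staircases `S_b, S_c` under the uniform weight. [cite: LiebSahi2021, Lemma 2.4] -/
theorem F2_nonneg {b c : Fin m → ℕ} (hb : IsStair m b) (hc : IsStair m c) : 0 ≤ F2 m b c := by
  classical
  rcases Nat.eq_zero_or_pos m with hm | hm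
  · subst hm
    simp [F2, S]
  have h := ex_mul_ex_le_ex_mul_of_antitone hm (f := setInd (stairSet b)) (g := setInd (stairSet c))
    (fun x => setInd_nonneg _ _) (fun x => setInd_nonneg _ _)
    (antitone_setInd_of_isLowerSet (isLowerSet_stairSet hb.1))
    (antitone_setInd_of_isLowerSet (isLowerSet_stairSet hc.1))
  have hbc : ∀ i, (b ⊓ c) i ≤ m := fun i => (inf_le_left).trans (hb.2 i)
  rw [setInd_mul, ← stairSet_inf, ex_setInd_stairSet hb.2, ex_setInd_stairSet hc.2,
    ex_setInd_stairSet hbc] at h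
  have hm' : (0 : ℝ) < (m : ℝ) ^ 2 := by positivity
  unfold F2
  rw [div_mul_div_comm, div_le_div_iff₀ (by positivity) hm'] at h
  nlinarith [h, hm']

/-- **Theorem 2.9** [LiebSahi2021] (scaled by `m⁶`): `E_3(a, b, c) ≥ 0` for all `a, b, c ∈ 𝒜(m)`.
[cite: LiebSahi2021, Thm. 2.9] -/
theorem F3_nonneg {a b c : Fin m → ℕ} (ha : IsStair m a) (hb : IsStair m b) (hc : IsStair m c) :
    0 ≤ F3 m a b c :=
  F3_nonneg_of_F2 (fun _ _ hb hc => F2_nonneg hb hc) ha hb hc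

/-! ### Transport to `sahiE` on the grid -/

/-- `E_3(χ_a, χ_b, χ_c) = E_3(a, b, c)`: the tree's `E_3` of the three staircase indicators under the uniform
weight is `F3/m⁶`. [cite: LiebSahi2021, §2.1 ("E_3(a,b,c) = E_3(χ_a,χ_b,χ_c)")] -/
theorem sahiE_three_stairSet (hm : 0 < m) {a b c : Fin m → ℕ} (ha : ∀ i, a i ≤ m) (hb : ∀ i, b i ≤ m)
    (hc : ∀ i, c i ≤ m) :
    sahiE (gridWeight m) 3 ![setInd (stairSet a), setInd (stairSet b), setInd (stairSet c)] =
      F3 m a b c / ((m : ℝ) ^ 2) ^ 3 := by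
  have hab : ∀ i, (a ⊓ b) i ≤ m := fun i => (inf_le_left).trans (ha i)
  have hac : ∀ i, (a ⊓ c) i ≤ m := fun i => (inf_le_left).trans (ha i)
  have hbc : ∀ i, (b ⊓ c) i ≤ m := fun i => (inf_le_left).trans (hb i)
  have habc : ∀ i, (a ⊓ b ⊓ c) i ≤ m := fun i => (inf_le_left).trans (hab i)
  rw [sahiE_three]
  simp only [setInd_mul, ← stairSet_inf]
  rw [ex_setInd_stairSet ha, ex_setInd_stairSet hb, ex_setInd_stairSet hc, ex_setInd_stairSet hab,
    ex_setInd_stairSet hac, ex_setInd_stairSet hbc, ex_setInd_stairSet habc]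
  have hm' : (m : ℝ) ≠ 0 := by exact_mod_cast hm.ne'
  unfold F3
  field_simp

/-- **Theorem 2.9 in the tree's vocabulary**: under the uniform probability weight on the `m × m` grid,
`E_3(χ_{S_a}, χ_{S_b}, χ_{S_c}) ≥ 0` for all staircases. [cite: LiebSahi2021, Thm. 2.9] -/
theorem liebSahi_thm29 (hm : 0 < m) {a b c : Fin m → ℕ} (ha : IsStair m a) (hb : IsStair m b)
    (hc : IsStair m c) :
    0 ≤ sahiE (gridWeight m) 3 ![setInd (stairSet a), setInd (stairSet b), setInd (stairSet c)] := by
  rw [sahiE_three_stairSet hm ha.2 hb.2 hc.2]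
  exact div_nonneg (F3_nonneg ha hb hc) (by positivity)

/-- `E_3 ≥ 0` for the indicators of any three DOWN-sets of the grid, uniform weight (every down-set is a
staircase). [cite: LiebSahi2021, Thm. 2.9 with Lemma 2.2] -/
theorem sahiE_three_setInd_nonneg_of_isLowerSet_grid (hm : 0 < m) {L₁ L₂ L₃ : Finset (Fin m × Fin m)}
    (h₁ : IsLowerSet ((L₁ : Finset (Fin m × Fin m)) : Set (Fin m × Fin m)))
    (h₂ : IsLowerSet ((L₂ : Finset (Fin m × Fin m)) : Set (Fin m × Fin m)))
    (h₃ : IsLowerSet ((L₃ : Finset (Fin m × Fin m)) : Set (Fin m × Fin m))) :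
    0 ≤ sahiE (gridWeight m) 3 ![setInd L₁, setInd L₂, setInd L₃] := by
  obtain ⟨a, ha, rfl⟩ := exists_stair_eq_of_isLowerSet L₁ h₁
  obtain ⟨b, hb, rfl⟩ := exists_stair_eq_of_isLowerSet L₂ h₂
  obtain ⟨c, hc, rfl⟩ := exists_stair_eq_of_isLowerSet L₃ h₃
  exact liebSahi_thm29 hm ha hb hc

/-- The same for three UP-sets, by the reflection of the grid. [cite: LiebSahi2021, Thm. 2.1 and §2 (x_i ↦ 1 − x_i)] -/
theorem sahiE_three_setInd_nonneg_of_isUpperSet_grid (hm : 0 < m) {U₁ U₂ U₃ : Finset (Fin m × Fin m)}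
    (h₁ : IsUpperSet ((U₁ : Finset (Fin m × Fin m)) : Set (Fin m × Fin m)))
    (h₂ : IsUpperSet ((U₂ : Finset (Fin m × Fin m)) : Set (Fin m × Fin m)))
    (h₃ : IsUpperSet ((U₃ : Finset (Fin m × Fin m)) : Set (Fin m × Fin m))) :
    0 ≤ sahiE (gridWeight m) 3 ![setInd U₁, setInd U₂, setInd U₃] := by
  classical
  -- the reflected sets are down-sets
  let L : Finset (Fin m × Fin m) → Finset (Fin m × Fin m) := fun U => univ.filter fun x => gridRev m x ∈ U
  have hL : ∀ {U : Finset (Fin m × Fin m)}, IsUpperSet ((U : Finset (Fin m × Fin m)) : Set (Fin m × Fin m)) →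
      IsLowerSet ((L U : Finset (Fin m × Fin m)) : Set (Fin m × Fin m)) := by
    intro U hU x y hyx hx
    rw [Finset.mem_coe, Finset.mem_filter] at hx ⊢
    exact ⟨mem_univ _, hU (gridRev_antitone hyx) hx.2⟩
  have hind : ∀ U : Finset (Fin m × Fin m), setInd U ∘ gridRev m = setInd (L U) := by
    intro U
    funext x
    simp only [Function.comp_apply, setInd_apply, L, Finset.mem_filter, Finset.mem_univ, true_and]
  have key := sahiE_comp_equiv (gridRev m) (gridWeight m) 3 ![setInd U₁, setInd U₂, setInd U₃]
  have hμ : gridWeight m ∘ gridRev m = gridWeight m := rfl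
  have hf : (fun i => (![setInd U₁, setInd U₂, setInd U₃] : Fin 3 → Fin m × Fin m → ℝ) i ∘ gridRev m) =
      ![setInd (L U₁), setInd (L U₂), setInd (L U₃)] := by
    funext i
    fin_cases i
    · exact hind U₁
    · exact hind U₂
    · exact hind U₃
  rw [← key, hμ, hf]
  exact sahiE_three_setInd_nonneg_of_isLowerSet_grid hm (hL h₁) (hL h₂) (hL h₃)

/-- **Lieb–Sahi's Theorem 2.1, discrete form: order-3 Sahi positivity of the uniform weight on the square
grid.**  For every `m ≥ 1`, `E_3(f, g, h) ≥ 0` for all nonnegative monotone `f, g, h` on `Fin m × Fin m` under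
the uniform probability weight — Theorem 2.9 plus the layer cake (Lemma 2.2) and the reflection; the passage
to Lebesgue measure on `[0,1]²` (Lemma 2.3, an `L¹` limit) is not formalised.
[cite: LiebSahi2021, Thm. 2.1 (via Lemma 2.2 and Thm. 2.9)] -/
theorem sahiPositive_three_uniformGrid (hm : 0 < m) : SahiPositive (gridWeight m) 3 := by
  classical
  rw [sahiPositive_iff_indicators]
  intro U hU
  have hfam : (fun i => setInd (U i)) = ![setInd (U 0), setInd (U 1), setInd (U 2)] := by
    funext i
    fin_cases i <;> rfl
  rw [hfam]
  exact sahiE_three_setInd_nonneg_of_isUpperSet_grid hm (hU 0) (hU 1) (hU 2)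

end LiebSahiGrid

end Literature.Combinatorics.Sahi2008
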